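import Summits.ABC.IUTFork.Repair.RHLabelCutJ2K2
import Summits.ABC.IUTFork.Repair.CandInternal11GapLabelCut
import Summits.ABC.IUTFork.Repair.EvalI06StarGenuine
import Summits.ABC.IUTFork.Cor312ProvKRamifiedLabel
import Summits.ABC.IUTFork.Repair.RHLabelCutJ3UnramOdd
import HarnessLib

/-!
# IUT REPAIR branch → R-H ROUND 1, ROW 9 «label-cut-j3»: the k2 TEST against the UNRAMIFIED-ODD refutation family —
# the cut `j ≤ 3` keeps the labels `j = 2, 3`, and the family is label-free from `j = 2` on

PROOF-ONLY (0 definitions, 0 `Prop` facts, no instance, no notation; abc-iut cell, rung LADDER-ABC:A2.RESCUE.H; seat abc-iut-rh-tst-9 =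
R-H ROUND 1 PAIR n = 9 TESTER, director-abc W13 (A) item k2). ROW 9 of `plan/rescue/R-H/RH-CANDIDATES.tsv` v1 (sha16 f7773e15cd7f6906,
text unchanged through v1.6), informal statement VERBATIM: «I06* cells at labels j<=3 only: h(w,3) = 8H/(2l) <= kappa_minus(w)», scope «all bad
places», cut class C1 / G2, k2 door «as row 1 (licence_of_starOn + off-window input; budget door)». The «unramified-odd refutation family» =
the landed Negative lemmas that killed RP-I06⋆ as typed: `CandInternal2Real.not_mem_jsq_smul_logShell_of_unramified` (element, `2 ≤ j`),
the `κ⁻/κ⁺` column arithmetic (`RHLabelCutJ2K2` §2, `CandInternal11GapLabelCutArith`), `EvalHonestCeiling.i06_false_of_honest` (region), and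
at genuine pilot data the tame closed form `EvalI06StarGenuine.qIdele_mem_thetaIdele_smul_logShell_iff_of_tame`.

FINDING (every clause a theorem below; one-line instances BY NAME of landed lemmas; sibling of abc-iut-rh-tst-1's `RHLabelCutJ2K2`, p458420):
* §0 MONOTONICITY: the cut-`3` predicate implies the cut-`2` predicate at every level (element: `labelsLeTwo_of_labelsLeThree`; set level:
  `CandInternal11GapLabelCut.starBelow_anti`, `starBelowTwo_of_starBelowThree`), so EVERY refutation of row 1 refutes row 9 — row 9 is the
  STRONGER hypothesis; and on data with `l⋆ ≤ 3` (`l ∈ {5, 7}`) the cut-`3` predicate IS abc-iut-rp-d2's full `HQShellOrbitStar`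
  (`starBelowThree_iff_star_of_lstar_le_three`).
* §1 ELEMENT: at every unramified odd datum (`K ⊇ ℚ_p` complete, `p ≠ 2`, `e(K/ℚ_p) = 1`, `q̲` a nonzero non-unit) the `j = 3` cell
  `q̲ ∈ q̲^{3²}·ℐ_K` is FALSE (`cellThree_false_of_unramified`), as is the `j = 2` cell, hence «labels ≤ 3» is false there for every `l` and every
  local height (`labelsLeThree_false_of_unramified`), also read only at its non-trivial labels `2 ≤ j ≤ 3` (`windowTwoThree_false_of_unramified`);
  table witness: I06STAR-COLUMNS v1 row `concrete:Cor312LicenceSharpRat@p7.j3` (rw_row S-RAT, `e_w = 1`) = `padicSeven_cellThree_false`.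
* §2 COLUMN: `κ⁻ = κ⁺ = 0` at `e = 1`, `p` odd (`RHLabelCutJ2K2` §2), so the row's POS door «`h(w,3) = 8H/(2l) ≤ κ⁻(w)`» is SHUT and the NEG
  door `8H > 2l·κ⁺` FIRES at `j = 3` for every `H > 0`, every `l` (`posDoor_cellThree_false_…`, `negDoor_cellThree_…`; general label
  `posDoor_false_of_unramified_odd`); both cuts `⌊√(1 + 2l·κ∓/H)⌋ = 1 < 3` (`lowerCut_lt_three_…`, `upperCut_lt_three_…`); and by
  `RHLabelCutJ2K2.label_le_one_of_mem_of_unramified_odd` no `q̲` with `‖q̲‖^{2l} = p^{−H}` satisfies the `j = 3` cell (`cellThree_false_of_norm_eq`).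
* §3 GENUINE TWO-ELEMENT CELL (realising ideles of ANY pilot datum `X`, abc-iut-rp-x3's `EvalI06StarGenuine`): at a bad place `x | p`, `p > 2`,
  with `e_x = 1`, `t_{q,x} ∉ t_{Θ,i+1,x}·ℐ_x` at EVERY label `i+1 ≥ 2` (`qIdele_not_mem_thetaIdele_smul_logShell_of_unramified_odd`: tame closed
  form, POS ⟺ `((i+1)²−1)·ord_x(q) ≤ 2l·(e_x − 1) = 0`, and `ord_x(q) > 0`); hence the genuine «labels ≤ 3» predicate at `x` is false
  (`genuineLabelsLeThree_false_of_unramified_odd`, label `2` is in the window since `l⋆ ≥ 2`). SCOPE, as a theorem: at print's own `K`-level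
  datum `Cor312Prov.pilotDataOfK D K` every bad completion has `e_x ≥ l ≥ 5` (abc-iut-w5-d054 / `Cor312Prov.l_le_absRamificationIdx_kOf_pilotDataOfK`),
  so the unramified-odd stratum is EMPTY there (`absRamificationIdx_ne_one_pilotDataOfK`) — at that typing the family MISSES row 9 by scope and
  the row is decided by k1 (HEX 16/256), not by k2.
* §4 REGION (honest bed): the below-cut predicate of abc-iut-rp-h3's `CandInternal11GapLabelCut.licence_of_starBelow` — LITERALLY its `hbelow`
  binder — is FALSE for every cut `j₀` with `2 ≤ j₀(v_ℚ)` at one place carrying an honest cell at label `2` (`starBelow_false_of_honest`), in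
  particular for the constant cut `3` (`starBelowThree_false_of_honest`), and under `BridgeHyps` with honest scaling at every cell the cut-`3` row
  has NO SAT+ witness (`no_satPlus_starBelowThree`) — the ceiling of `EvalHonestCeiling.i06_false_of_honest` is a one-cell phenomenon at label `2`.
* §5 ARITHMETIC: the row's POS form in the table's `x`-integer currency, `8·m_q ≤ d⁻ = c·e − ⌈e/(p−2)⌉ = 0` at `e = 1`, is false for `m_q ≥ 1`
  (`posFormInt_false_of_unramified_odd`).
* §6 AGAINST THE LANDED DECL (p459152 `RH.LabelCutJ3.HStar`, companion bridge `RHLabelCutJ3UnramOdd`): `bridgeHyps_false_pilotDataOfK`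
  (the bridge's two hypotheses prove `False`), `not_exists_unramified_badPlace_pilotDataOfK` (the family's trigger set at the genuine datum is
  empty), `not_hStar_of_absRamificationIdx_eq_one_vacuous` (the bridge's conclusion by `False.elim` alone) — k2 verdict for the landed typing: PASS-BY-SCOPE (kernel), not a kill; the landed decl is decided by k1.

HONEST SCOPE. Classical `p`-adic analysis at one local field, real/integer arithmetic, and three-line volume bookkeeping; nothing here asserts or
refutes abc, takes a side on [IUTchIII] Cor. 3.12 or on any author; row 9 is a HYPOTHESIS under test; typed ≠ proved; tested ≠ endorsed.
The predicates tested are the row text's announced typings (abstract window = §4's binder, genuine two-element cell = §3, arithmetic POS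
form = §2/§5), each spelled INLINE, AND (§6) abc-iut-rh-typ-9's LANDED deciding declaration `RH.LabelCutJ3.HStar D tq := StarBelow D tq 3`
(p459152, at print's `K`-level datum only): there the family MISSES BY SCOPE — the hypothesis pair of abc-iut-rh-typ-9's bridge
`RH.LabelCutJ3K2Bridge.not_hStar_of_absRamificationIdx_eq_one` («`w` bad» ∧ «`e(K_w/ℚ_p) = 1`») is jointly UNSATISFIABLE
(`bridgeHyps_false_pilotDataOfK`), so that bridge is vacuous and no member of the family decides `HStar D tq`; the landed decl is decided by k1.
[cite: MochizukiAbsTopIII2015, Def 5.4 (iii) p. 126] [claim: Mochizuki2012, status: disputed] for the [IUTchIV] Prop. 1.2 exponents and every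
IUT locution. Axioms: standard (propext, Classical.choice, Quot.sound).
-/

noncomputable section

namespace Summit.ABC.IUTFork.Repair.RHLabelCutJ3K2

open Set Metric
open scoped Pointwise
open Literature.AnabelianGeometry.AbsoluteAnabelian Literature.IUT.LogThetaLattice Literature.IUT.LogVolume

/-! ## §1. Element form: the `j = 3` (and `j = 2`) cell at an unramified odd datum -/

section Element

variable (p : ℕ) [Fact p.Prime]
variable (K : Type*) [NontriviallyNormedField K] [NormedAlgebra ℚ_[p] K] [IsUltrametricDist K] [ProperSpace K]

/-- **§0 at element level: «cells at all labels `j ≤ 3`» implies «cells at all labels `j ≤ 2`»** — row 9 is the stronger hypothesis. [folklore] -/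
theorem labelsLeTwo_of_labelsLeThree {q : K} (h : ∀ j ≤ 3, q ∈ q ^ (j ^ 2) • logShell (PadicLogOnUnits.ofUnitLog p K)) :
    ∀ j ≤ 2, q ∈ q ^ (j ^ 2) • logShell (PadicLogOnUnits.ofUnitLog p K) := fun j hj =>
  h j (hj.trans (by norm_num))

/-- **The `j = 3` I06⋆ cell is FALSE at every unramified odd datum**: `K ⊇ ℚ_p` complete with `e = 1`, `p ≠ 2`, `q̲ ≠ 0`, `‖q̲‖ < 1` ⟹
`q̲ ∉ q̲^{3²} · ℐ_K` — `CandInternal2Real.not_mem_jsq_smul_logShell_of_unramified` at `j := 3`. [cite: MochizukiAbsTopIII2015, Def 5.4 (iii) p. 126] -/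
theorem cellThree_false_of_unramified (hp : p ≠ 2) (he : absRamificationIdx p K = 1) {q : K} (hq0 : q ≠ 0) (hq1 : ‖q‖ < 1) :
    q ∉ q ^ (3 ^ 2) • logShell (PadicLogOnUnits.ofUnitLog p K) :=
  CandInternal2Real.not_mem_jsq_smul_logShell_of_unramified p K hp he hq0 hq1 (by norm_num)

/-- Both window labels `j = 2, 3` of row 9 fail there (the `j = 2` instance is abc-iut-rh-tst-1's `RHLabelCutJ2K2.cellTwo_false_of_unramified`).
[cite: MochizukiAbsTopIII2015, Def 5.4 (iii) p. 126] -/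
theorem cellTwo_and_cellThree_false_of_unramified (hp : p ≠ 2) (he : absRamificationIdx p K = 1) {q : K} (hq0 : q ≠ 0) (hq1 : ‖q‖ < 1) :
    q ∉ q ^ (2 ^ 2) • logShell (PadicLogOnUnits.ofUnitLog p K) ∧ q ∉ q ^ (3 ^ 2) • logShell (PadicLogOnUnits.ofUnitLog p K) :=
  ⟨RHLabelCutJ2K2.cellTwo_false_of_unramified p K hp he hq0 hq1, cellThree_false_of_unramified p K hp he hq0 hq1⟩

/-- **Row 9's one-place predicate «all I06⋆ cells at labels `j ≤ 3`» is FALSE at every unramified odd datum** (`RHLabelCutJ2K2.labelsLe_false_of_unramified`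
at the cut `j₀ := 3`). [cite: MochizukiAbsTopIII2015, Def 5.4 (iii) p. 126] -/
theorem labelsLeThree_false_of_unramified (hp : p ≠ 2) (he : absRamificationIdx p K = 1) {q : K} (hq0 : q ≠ 0) (hq1 : ‖q‖ < 1) :
    ¬ ∀ j ≤ 3, q ∈ q ^ (j ^ 2) • logShell (PadicLogOnUnits.ofUnitLog p K) :=
  RHLabelCutJ2K2.labelsLe_false_of_unramified p K hp he hq0 hq1 (by norm_num)

/-- The same read only at the NON-TRIVIAL window labels `2 ≤ j ≤ 3` (the label `j = 1` cell `q̲ ∈ q̲·ℐ` is not where the row lives): false there.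
[cite: MochizukiAbsTopIII2015, Def 5.4 (iii) p. 126] -/
theorem windowTwoThree_false_of_unramified (hp : p ≠ 2) (he : absRamificationIdx p K = 1) {q : K} (hq0 : q ≠ 0) (hq1 : ‖q‖ < 1) :
    ¬ ∀ j : ℕ, 2 ≤ j → j ≤ 3 → q ∈ q ^ (j ^ 2) • logShell (PadicLogOnUnits.ofUnitLog p K) := fun h =>
  cellThree_false_of_unramified p K hp he hq0 hq1 (h 3 (by norm_num) le_rfl)

/-- **The explicit datum `K = ℚ_p`, `q̲ = p`** (`p` odd): `p ∉ p^{3²} · ℐ_{ℚ_p}`. [cite: MochizukiAbsTopIII2015, Def 5.4 (iii) p. 126] -/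
theorem padic_cellThree_false (hp : p ≠ 2) :
    (p : ℚ_[p]) ∉ (p : ℚ_[p]) ^ (3 ^ 2) • logShell (PadicLogOnUnits.ofUnitLog p ℚ_[p]) :=
  cellThree_false_of_unramified p ℚ_[p] hp (absRamificationIdx_padic p)
    (by exact_mod_cast (Fact.out : p.Prime).ne_zero) Padic.norm_p_lt_one

end Element

/-- **The S-RAT table cell at `j = 3`** (I06STAR-COLUMNS v1 row `concrete:Cor312LicenceSharpRat@p7.j3`, `p = 7`, `e_w = 1`): `7 ∉ 7^{9} · ℐ_{ℚ_7}`.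
[cite: MochizukiAbsTopIII2015, Def 5.4 (iii) p. 126] -/
theorem padicSeven_cellThree_false [Fact (Nat.Prime 7)] :
    ((7 : ℕ) : ℚ_[7]) ∉ ((7 : ℕ) : ℚ_[7]) ^ (3 ^ 2) • logShell (PadicLogOnUnits.ofUnitLog 7 ℚ_[7]) :=
  padic_cellThree_false 7 (by norm_num)

/-! ## §2. Column form: the POS door of row 9 is shut and the NEG door fires at `j = 3` (indeed at every `j ≥ 2`) -/

section Column

/-- **POS door shut at every label `j ≥ 2`** at an unramified odd place: `¬ ((j²−1)·H ≤ 2l·κ⁻)` for `H > 0`, since `κ⁻ = c − a_1 = 0`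
(`RHLabelCutJ2K2.kappaMinus_eq_zero_of_unramified_odd`; casts exactly as in `CandInternal2RealLabels.jsq_root_window`).
[cite: MochizukiAbsTopIII2015, Def 5.4 (iii) p. 126] -/
theorem posDoor_false_of_unramified_odd {p : ℕ} (hp : 2 < p) (l : ℕ) {H : ℝ} (hH : 0 < H) {j : ℕ} (hj : 2 ≤ j) :
    ¬ ((((j ^ 2 : ℕ) : ℝ) - 1) * H ≤ ((2 * l : ℕ) : ℝ) * (((if p = 2 then 2 else 1 : ℕ) : ℝ) - logRadiusA p 1)) := by
  rw [RHLabelCutJ2K2.kappaMinus_eq_zero_of_unramified_odd hp, mul_zero, not_le]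
  have h4 : (4 : ℝ) ≤ ((j ^ 2 : ℕ) : ℝ) := by
    have : 2 ^ 2 ≤ j ^ 2 := Nat.pow_le_pow_left hj 2
    exact_mod_cast this
  have : 0 < (((j ^ 2 : ℕ) : ℝ) - 1) := by linarith
  positivity

/-- **Row 9's own door «`h(w,3) = 8H/(2l) ≤ κ⁻(w)`» is SHUT** at an unramified odd place, every `l`, every `H > 0`.
[cite: MochizukiAbsTopIII2015, Def 5.4 (iii) p. 126] -/
theorem posDoor_cellThree_false_of_unramified_odd {p : ℕ} (hp : 2 < p) (l : ℕ) {H : ℝ} (hH : 0 < H) :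
    ¬ ((((3 ^ 2 : ℕ) : ℝ) - 1) * H ≤ ((2 * l : ℕ) : ℝ) * (((if p = 2 then 2 else 1 : ℕ) : ℝ) - logRadiusA p 1)) :=
  posDoor_false_of_unramified_odd hp l hH (by norm_num)

/-- **NEG door fires at `j = 3`**: even the NECESSARY inequality `(3²−1)·H ≤ 2l·κ⁺` fails for `H > 0` (`κ⁺ = b_1 + c = 0`).
[cite: MochizukiAbsTopIII2015, Def 5.4 (iii) p. 126] -/
theorem negDoor_cellThree_of_unramified_odd {p : ℕ} (hp : 2 < p) (l : ℕ) {H : ℝ} (hH : 0 < H) :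
    ¬ ((((3 ^ 2 : ℕ) : ℝ) - 1) * H ≤ ((2 * l : ℕ) : ℝ) * (logRadiusB p 1 + ((if p = 2 then 2 else 1 : ℕ) : ℝ))) := by
  rw [RHLabelCutJ2K2.kappaPlus_eq_zero_of_unramified_odd hp, mul_zero, not_le]
  have : (((3 ^ 2 : ℕ) : ℝ) - 1) = 8 := by norm_num
  rw [this]
  positivity

/-- **The sufficient cut is `1 < 3`** at an unramified odd place (`⌊√(1 + 2l·κ⁻/H)⌋₊ = 1`). [folklore] -/
theorem lowerCut_lt_three_of_unramified_odd {p : ℕ} (hp : 2 < p) (l : ℕ) (H : ℝ) :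
    ⌊Real.sqrt (1 + 2 * (l : ℝ) * (((if p = 2 then 2 else 1 : ℕ) : ℝ) - logRadiusA p 1) / H)⌋₊ < 3 := by
  rw [RHLabelCutJ2K2.lowerCut_eq_one_of_unramified_odd hp]
  norm_num

/-- **The necessary cut is `1 < 3`** at an unramified odd place (`⌊√(1 + 2l·κ⁺/H)⌋₊ = 1`): no I06⋆ cell can hold there at any label `≥ 2`.
[folklore] -/
theorem upperCut_lt_three_of_unramified_odd {p : ℕ} (hp : 2 < p) (l : ℕ) (H : ℝ) :
    ⌊Real.sqrt (1 + 2 * (l : ℝ) * (logRadiusB p 1 + ((if p = 2 then 2 else 1 : ℕ) : ℝ)) / H)⌋₊ < 3 := by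
  rw [RHLabelCutJ2K2.upperCut_eq_one_of_unramified_odd hp]
  norm_num

/-- The column verdict tied back to the element: at a local field with `e = 1`, `p` odd, `‖q̲‖^{2l} = p^{−H}`, `H > 0`, `l > 0`, the `j = 3`
cell fails (every holding label is `≤ 1` by `RHLabelCutJ2K2.label_le_one_of_mem_of_unramified_odd`). [cite: MochizukiAbsTopIII2015, Def 5.4 (iii) p. 126] -/
theorem cellThree_false_of_norm_eq (p : ℕ) [Fact p.Prime] (K : Type*) [NontriviallyNormedField K] [NormedAlgebra ℚ_[p] K]
    [IsUltrametricDist K] [ProperSpace K] (hp : 2 < p) (he : absRamificationIdx p K = 1) {q : K} (hq : q ≠ 0) {l : ℕ} (hl : 0 < l)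
    {H : ℝ} (hH : 0 < H) (hqN : ‖q‖ ^ (2 * l) = (p : ℝ) ^ (-H)) :
    q ∉ q ^ (3 ^ 2) • logShell (PadicLogOnUnits.ofUnitLog p K) := fun hmem =>
  absurd (RHLabelCutJ2K2.label_le_one_of_mem_of_unramified_odd p K hp he hq hl hH hqN hmem) (by norm_num)

end Column

/-! ## §3. The GENUINE two-element cell of `EvalI06StarGenuine` at an unramified odd bad place of any pilot datum; scope at `pilotDataOfK` -/

section Realising

open NumberField IsDedekindDomain Thm311 Thm311.Real Cor312 Cor312Vol Cor312Prov

variable {F : Type} [Field F] [NumberField F] (X : PilotData F)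
  (t : ∀ (pp : Nat.Primes) (_ : Fin X.lstar) (x : (thetaIndex X).Fibre (.inr pp)),
    haveI : Fact (pp : ℕ).Prime := ⟨pp.2⟩; kOf X pp.1 x)
  (ht0 : ∀ pp i x, t pp i x ≠ 0)
  (ht : ∀ (pp : Nat.Primes) (i : Fin X.lstar) (x : (thetaIndex X).Fibre (.inr pp)),
    haveI : Fact (pp : ℕ).Prime := ⟨pp.2⟩
    Real.log ‖t pp i x‖ = -(X.thetaPilot i (placeOf X pp.1 x)) * logNorm F (placeOf X pp.1 x) /
      localDegree F (placeOf X pp.1 x))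
  (tq : ∀ (pp : Nat.Primes) (x : (thetaIndex X).Fibre (.inr pp)), haveI : Fact (pp : ℕ).Prime := ⟨pp.2⟩; kOf X pp.1 x)
  (htq0 : ∀ pp x, tq pp x ≠ 0)
  (htq : ∀ (pp : Nat.Primes) (x : (thetaIndex X).Fibre (.inr pp)),
    haveI : Fact (pp : ℕ).Prime := ⟨pp.2⟩
    Real.log ‖tq pp x‖ = -(X.qPilot (placeOf X pp.1 x)) * logNorm F (placeOf X pp.1 x) /
      localDegree F (placeOf X pp.1 x))

include ht0 ht htq0 htq in
/-- **Genuine cell NEG at every label `≥ 2` at an unramified odd bad place.** For realising ideles of ANY pilot datum `X` and a bad place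
`x | p`, `p > 2`, with `e_x = 1`: `t_{q,x} ∉ t_{Θ,i+1,x}·ℐ_x` for every `i ≥ 1` — by abc-iut-rp-x3's tame closed form
`EvalI06StarGenuine.qIdele_mem_thetaIdele_smul_logShell_iff_of_tame` (POS ⟺ `((i+1)²−1)·ord_x(q) ≤ 2l·(e_x − 1) = 0`) and `ord_x(q) > 0`.
[cite: MochizukiAbsTopIII2015, Def 5.4 (iii) p. 126] [cite: DupuyHilado2025, §3.4] -/
theorem qIdele_not_mem_thetaIdele_smul_logShell_of_unramified_odd (pp : Nat.Primes) [Fact (pp : ℕ).Prime] (hp : 2 < (pp : ℕ))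
    (i : Fin X.lstar) (hi : 1 ≤ (i : ℕ)) (x : (thetaIndex X).Fibre (.inr pp)) (hx : placeOf X pp.1 x ∈ X.S)
    (he : absRamificationIdx pp (kOf X pp.1 x) = 1) :
    tq pp x ∉ t pp i x • logShell (PadicLogOnUnits.ofUnitLog (pp : ℕ) (kOf X pp.1 x)) := by
  rw [EvalI06StarGenuine.qIdele_mem_thetaIdele_smul_logShell_iff_of_tame X t ht0 ht tq htq0 htq pp hp i x hx (by rw [he]; omega)]
  have hram := he
  rw [absRamificationIdx_rescaledCompletion F pp.1 (placeOf X pp.1 x) (natCast_mem_placeOf X pp.1 x)] at hram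
  have hord : (0 : ℤ) < X.ordq (placeOf X pp.1 x) := by exact_mod_cast X.ordq_pos hx
  have hi2 : (2 : ℤ) ≤ ((i : ℕ) : ℤ) + 1 := by omega
  have hram' : (((placeOf X pp.1 x).asIdeal.ramificationIdx ℤ : ℕ) : ℤ) = 1 := by exact_mod_cast hram
  rw [hram', sub_self, mul_zero]
  intro hle
  have hsq : (0 : ℤ) < (((i : ℕ) : ℤ) + 1) ^ 2 - 1 := by nlinarith
  exact absurd hle (not_le.2 (mul_pos hsq hord))

include ht0 ht htq0 htq in
/-- **Row 9's genuine-bed typing is FALSE at such a place**: «`t_{q,x} ∈ t_{Θ,i+1,x}·ℐ_x` at every label `i+1 ≤ 3`» fails at the label `2`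
(`i = 1`, in range since `l⋆ ≥ 2` for every pilot datum, `PilotData.two_le_lstar`). [cite: MochizukiAbsTopIII2015, Def 5.4 (iii) p. 126] -/
theorem genuineLabelsLeThree_false_of_unramified_odd (pp : Nat.Primes) [Fact (pp : ℕ).Prime] (hp : 2 < (pp : ℕ))
    (x : (thetaIndex X).Fibre (.inr pp)) (hx : placeOf X pp.1 x ∈ X.S) (he : absRamificationIdx pp (kOf X pp.1 x) = 1) :
    ¬ ∀ i : Fin X.lstar, (i : ℕ) + 1 ≤ 3 → tq pp x ∈ t pp i x • logShell (PadicLogOnUnits.ofUnitLog (pp : ℕ) (kOf X pp.1 x)) := fun h =>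
  qIdele_not_mem_thetaIdele_smul_logShell_of_unramified_odd X t ht0 ht tq htq0 htq pp hp ⟨1, X.two_le_lstar⟩ le_rfl x hx he
    (h ⟨1, X.two_le_lstar⟩ (by norm_num))

end Realising

section Genuine

open NumberField IsDedekindDomain Thm311 Thm311.Real Cor312 Cor312Vol Cor312Prov Literature.IUT.HodgeTheaters

variable {F K Fbar : Type} [Field F] [NumberField F] [Field K] [NumberField K] [Algebra F K] [Field Fbar]
  [Algebra F Fbar] [Algebra K Fbar] {E : WeierstrassCurve F} [E.IsElliptic] {l : ℕ} {Pb : BadPlacePredicates K}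
  (D : InitialThetaData F K Fbar E l Pb)

/-- **SCOPE (kernel): the unramified-odd stratum is EMPTY at print's own `K`-level pilot datum.** At every bad place `x₀ | p` of
`pilotDataOfK D K`: `e(K_{x₀}/ℚ_p) ≥ l ≥ 5`, so `e(K_{x₀}/ℚ_p) ≠ 1` — §3's hypothesis `he` never fires there (abc-iut-w5-d054's
`Cor312Prov.l_le_absRamificationIdx_kOf_pilotDataOfK` and [IUTchI] Def. 3.1 (c) `l ≥ 5`). [cite: Mochizuki2012, IUTchI Def. 3.1 (c),(e) pp. 61–62] -/
theorem absRamificationIdx_ne_one_pilotDataOfK (pp : Nat.Primes) [Fact (pp : ℕ).Prime]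
    (x₀ : (thetaIndex (pilotDataOfK D K)).Fibre (.inr pp)) (hx : placeOf (pilotDataOfK D K) pp.1 x₀ ∈ (pilotDataOfK D K).S) :
    absRamificationIdx (pp : ℕ) (kOf (pilotDataOfK D K) pp.1 x₀) ≠ 1 := by
  have h : l ≤ absRamificationIdx (pp : ℕ) (kOf (pilotDataOfK D K) pp.1 x₀) :=
    l_le_absRamificationIdx_kOf_pilotDataOfK D pp x₀ hx
  have h5 : 5 ≤ l := D.five_le_l
  omega

/-- … equivalently `2 ≤ e(K_{x₀}/ℚ_p)` (indeed `5 ≤`): every bad place of the genuine datum is (deeply) ramified. [cite: Mochizuki2012, IUTchI Def. 3.1 (c),(e) pp. 61–62] -/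
theorem five_le_absRamificationIdx_pilotDataOfK (pp : Nat.Primes) [Fact (pp : ℕ).Prime]
    (x₀ : (thetaIndex (pilotDataOfK D K)).Fibre (.inr pp)) (hx : placeOf (pilotDataOfK D K) pp.1 x₀ ∈ (pilotDataOfK D K).S) :
    5 ≤ absRamificationIdx (pp : ℕ) (kOf (pilotDataOfK D K) pp.1 x₀) :=
  D.five_le_l.trans (l_le_absRamificationIdx_kOf_pilotDataOfK D pp x₀ hx)

end Genuine

/-! ## §4. Region form: the below-cut predicate of `CandInternal11GapLabelCut.licence_of_starBelow` on the honest bed; §0 at set level -/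

section Region

open Thm311 Cor312 Cor312Vol Summit.ABC.IUTFork.Repair.CandInternal2 Summit.ABC.IUTFork.Repair.CandInternal11Gap

variable {T : ThetaIndex} (S : LatticeSituation T) (P : Cor312.Setting S.toSituation)
  (ρ : (∀ v : T.V, v ∈ T.Vbad → Set (S.L.StarPacket v)) → ∀ (j : T.Label) (vQ : T.VQ), Set (S.L.Packet j vQ))
  (qK : ∀ v : T.V, v ∈ T.Vbad → Set (S.L.StarPacket v))

/-- **§0 at set level: I06⋆ below the cut `3` gives I06⋆ below the cut `2`** (abc-iut-rp-h3's `CandInternal11GapLabelCut.starBelow_anti`):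
row 9 ⟹ row 1 cell-wise, so every refutation of row 1's below-cut predicate refutes row 9's. [folklore] -/
theorem starBelowTwo_of_starBelowThree
    (h3 : ∀ (i : Fin T.lstar) (vQ : T.VQ), (i : ℕ) + 1 ≤ (fun _ : T.VQ => 3) vQ →
      ρ qK (Setting.labelSucc i) vQ ⊆ ⋃ m : ℤ, ρ (shellSat S P.n ((S.col P.n).frobΨ m)) (Setting.labelSucc i) vQ) :
    ∀ (i : Fin T.lstar) (vQ : T.VQ), (i : ℕ) + 1 ≤ (fun _ : T.VQ => 2) vQ →
      ρ qK (Setting.labelSucc i) vQ ⊆ ⋃ m : ℤ, ρ (shellSat S P.n ((S.col P.n).frobΨ m)) (Setting.labelSucc i) vQ :=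
  CandInternal11GapLabelCut.starBelow_anti S P ρ qK (fun _ => by norm_num) h3

/-- **On data with `l⋆ ≤ 3` (`l ∈ {5, 7}`) the cut-`3` predicate IS the full `HQShellOrbitStar`** (I06⋆ at every label and place):
`CandInternal11GapLabelCut.starBelow_iff_star_of_lstar_le`. [folklore] -/
theorem starBelowThree_iff_star_of_lstar_le_three (hl : T.lstar ≤ 3) :
    (∀ (i : Fin T.lstar) (vQ : T.VQ), (i : ℕ) + 1 ≤ (fun _ : T.VQ => 3) vQ →
        ρ qK (Setting.labelSucc i) vQ ⊆ ⋃ m : ℤ, ρ (shellSat S P.n ((S.col P.n).frobΨ m)) (Setting.labelSucc i) vQ) ↔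
      HQShellOrbitStar S P ρ qK :=
  CandInternal11GapLabelCut.starBelow_iff_star_of_lstar_le S P ρ qK (fun _ => 3) fun _ => hl

/-- **One I06⋆ cell at a label `j = i+1 ≥ 2` has no honest witness** (q-pin, RP-I05b `HInd3Theta`, monotone log-volume, admissible
(Ind3)-region, exact `j²`-scaling and negative q-volume at that cell): abc-iut-rh-tst-1's `RHLabelCutJ2K2.cell_shellOrbit_false_of_honest`,
restated for use below. [folklore] -/
theorem cell_false_of_honest (hq : QPinned S P ρ qK) (hA : CandInternal2.HInd3Theta S P ρ) (hmono : LogvolMono P)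
    (i : Fin T.lstar) (hi : 1 ≤ (i : ℕ)) (vQ : T.VQ)
    (hθ : (S.D P.n).Adm _ vQ (P.thetaRegion3 (Setting.labelSucc i) vQ))
    (hscaled : (S.D P.n).logvol _ vQ (P.thetaRegion3 (Setting.labelSucc i) vQ) =
      (((i : ℕ) + 1 : ℕ) : ℝ) ^ 2 * P.qLocal (Setting.labelSucc i) vQ)
    (hneg : P.qLocal (Setting.labelSucc i) vQ < 0) :
    ¬ (ρ qK (Setting.labelSucc i) vQ ⊆ ⋃ m : ℤ, ρ (shellSat S P.n ((S.col P.n).frobΨ m)) (Setting.labelSucc i) vQ) :=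
  RHLabelCutJ2K2.cell_shellOrbit_false_of_honest S P ρ qK hq hA hmono i hi vQ hθ hscaled hneg

/-- **The below-cut predicate — LITERALLY the `hbelow` binder of `CandInternal11GapLabelCut.licence_of_starBelow` — is FALSE for every cut
`j₀` with `2 ≤ j₀(v_ℚ)` at a place `v_ℚ` carrying an honest cell at label `2`.** Covers row 1 (`j₀ ≡ 2`), row 9 (`j₀ ≡ 3`) and every C1 cut
that keeps label `2` somewhere. [folklore] -/
theorem starBelow_false_of_honest (j₀ : T.VQ → ℕ) (vQ : T.VQ) (hj : 2 ≤ j₀ vQ) (hq : QPinned S P ρ qK)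
    (hA : CandInternal2.HInd3Theta S P ρ) (hmono : LogvolMono P)
    (hθ : (S.D P.n).Adm _ vQ (P.thetaRegion3 (Setting.labelSucc ⟨1, T.two_le_lstar⟩) vQ))
    (hscaled : (S.D P.n).logvol _ vQ (P.thetaRegion3 (Setting.labelSucc ⟨1, T.two_le_lstar⟩) vQ) =
      (((1 : ℕ) + 1 : ℕ) : ℝ) ^ 2 * P.qLocal (Setting.labelSucc ⟨1, T.two_le_lstar⟩) vQ)
    (hneg : P.qLocal (Setting.labelSucc ⟨1, T.two_le_lstar⟩) vQ < 0) :
    ¬ (∀ (i : Fin T.lstar) (vQ : T.VQ), (i : ℕ) + 1 ≤ j₀ vQ →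
        ρ qK (Setting.labelSucc i) vQ ⊆ ⋃ m : ℤ, ρ (shellSat S P.n ((S.col P.n).frobΨ m)) (Setting.labelSucc i) vQ) := fun hbelow =>
  cell_false_of_honest S P ρ qK hq hA hmono ⟨1, T.two_le_lstar⟩ le_rfl vQ hθ hscaled hneg (hbelow ⟨1, T.two_le_lstar⟩ vQ hj)

/-- **Row 9: the constant cut `3`.** Under the honest clauses at ONE label-`2` cell the cut-`3` below-cut predicate is false — cutting the labels
`j ≥ 4` does not evade the ceiling of `EvalHonestCeiling.i06_false_of_honest`, which reads one cell at a label `≥ 2`. [folklore] -/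
theorem starBelowThree_false_of_honest (vQ : T.VQ) (hq : QPinned S P ρ qK) (hA : CandInternal2.HInd3Theta S P ρ) (hmono : LogvolMono P)
    (hθ : (S.D P.n).Adm _ vQ (P.thetaRegion3 (Setting.labelSucc ⟨1, T.two_le_lstar⟩) vQ))
    (hscaled : (S.D P.n).logvol _ vQ (P.thetaRegion3 (Setting.labelSucc ⟨1, T.two_le_lstar⟩) vQ) =
      (((1 : ℕ) + 1 : ℕ) : ℝ) ^ 2 * P.qLocal (Setting.labelSucc ⟨1, T.two_le_lstar⟩) vQ)
    (hneg : P.qLocal (Setting.labelSucc ⟨1, T.two_le_lstar⟩) vQ < 0) :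
    ¬ (∀ (i : Fin T.lstar) (vQ : T.VQ), (i : ℕ) + 1 ≤ (fun _ : T.VQ => 3) vQ →
        ρ qK (Setting.labelSucc i) vQ ⊆ ⋃ m : ℤ, ρ (shellSat S P.n ((S.col P.n).frobΨ m)) (Setting.labelSucc i) vQ) :=
  starBelow_false_of_honest S P ρ qK (fun _ => 3) vQ (by norm_num) hq hA hmono hθ hscaled hneg

/-- **… and under `BridgeHyps` alone with honest scaling and negative q-volume at every cell** (the form of `EvalHonestCeiling.no_satPlus_i06`):
the cut-`3` row has NO SAT+ witness at any place. [folklore] -/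
theorem no_satPlus_starBelowThree (vQ : T.VQ) (hB : BridgeHyps P) (hq : QPinned S P ρ qK) (hA : CandInternal2.HInd3Theta S P ρ)
    (hscaled : ∀ (i : Fin T.lstar) (vQ : T.VQ), (S.D P.n).logvol _ vQ (P.thetaRegion3 (Setting.labelSucc i) vQ) =
      (((i : ℕ) + 1 : ℕ) : ℝ) ^ 2 * P.qLocal (Setting.labelSucc i) vQ)
    (hneg : ∀ (i : Fin T.lstar) (vQ : T.VQ), P.qLocal (Setting.labelSucc i) vQ < 0) :
    ¬ (∀ (i : Fin T.lstar) (vQ : T.VQ), (i : ℕ) + 1 ≤ (fun _ : T.VQ => 3) vQ →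
        ρ qK (Setting.labelSucc i) vQ ⊆ ⋃ m : ℤ, ρ (shellSat S P.n ((S.col P.n).frobΨ m)) (Setting.labelSucc i) vQ) :=
  starBelowThree_false_of_honest S P ρ qK vQ hq hA hB.mono (Cor312Vol.PinnedHonest.thetaRegion3_adm S P hB ⟨1, T.two_le_lstar⟩ vQ)
    (hscaled ⟨1, T.two_le_lstar⟩ vQ) (hneg ⟨1, T.two_le_lstar⟩ vQ)

end Region

/-! ## §5. The row's POS form in the table's integer currency -/

/-- In the table's `x`-integer currency (`m_q = ord_x(q)/2l ≥ 1`, `d⁻ = c·e − ⌈e/(p−2)⌉ = 1·1 − 1 = 0` at `e = 1`, `p` odd): the `j = 3` POS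
form `(3² − 1)·m_q ≤ d⁻` is false. [folklore] -/
theorem posFormInt_false_of_unramified_odd {m : ℕ} (hm : 1 ≤ m) : ¬ ((3 ^ 2 - 1) * m ≤ 1 * 1 - 1) := by omega

/-! ## §6. Against the LANDED deciding declaration `RH.LabelCutJ3.HStar` (p459152): the family misses by scope; the bridge is vacuous -/

section Landed

open NumberField IsDedekindDomain Thm311 Thm311.Real Cor312 Cor312Vol Cor312Prov Literature.IUT.HodgeTheaters
  Summit.ABC.IUTFork.Repair.RH.LabelCutJ3

variable {F K Fbar : Type} [Field F] [NumberField F] [Field K] [NumberField K] [Algebra F K] [Field Fbar]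
  [Algebra F Fbar] [Algebra K Fbar] {E : WeierstrassCurve F} [E.IsElliptic] {l : ℕ} {Pb : BadPlacePredicates K}
  (D : InitialThetaData F K Fbar E l Pb)

/-- **VACUITY WITNESS for abc-iut-rh-typ-9's bridge `RH.LabelCutJ3K2Bridge.not_hStar_of_absRamificationIdx_eq_one`**: its two hypotheses —
«`w ∣ p` is a BAD place of `pilotDataOfK D K`» and «`e(K_w/ℚ_p) = 1`» — are jointly unsatisfiable (`e(K_w/ℚ_p) ≥ l ≥ 5` at bad places,
§3 `absRamificationIdx_ne_one_pilotDataOfK`), stated with the bridge's own binders. So the unramified-odd family never fires against the landed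
`HStar D tq`; that typing is decided by k1 alone. [cite: Mochizuki2012, IUTchI Def. 3.1 (c),(e) pp. 61–62] -/
theorem bridgeHyps_false_pilotDataOfK (pp : Nat.Primes) (w : (thetaIndex (pilotDataOfK D K)).Fibre (.inr pp))
    (hw : haveI : Fact (pp : ℕ).Prime := ⟨pp.2⟩; placeOf (pilotDataOfK D K) pp.1 w ∈ (pilotDataOfK D K).S)
    (he1 : haveI : Fact (pp : ℕ).Prime := ⟨pp.2⟩; absRamificationIdx (pp : ℕ) (kOf (pilotDataOfK D K) pp.1 w) = 1) : False := by
  haveI : Fact (pp : ℕ).Prime := ⟨pp.2⟩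
  exact absRamificationIdx_ne_one_pilotDataOfK D pp w hw he1

/-- **The trigger set of the family is EMPTY at the genuine datum**: there is NO bad place `w` of `pilotDataOfK D K` with `e(K_w/ℚ_p) = 1`.
Hence, whatever the truth value of the landed `HStar D tq = StarBelow D tq 3` (or of any cut `StarBelow D tq j₀`), it is not settled by the
unramified-odd lemmas: k2 = PASS-BY-SCOPE for the landed typing; the element/column/region refutations of §1–§4 live on the registered scope
«all bad places», which contains the `e_w = 1` rows of the round-1 table (S-RAT). [cite: Mochizuki2012, IUTchI Def. 3.1 (c),(e) pp. 61–62] -/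
theorem not_exists_unramified_badPlace_pilotDataOfK :
    ¬ ∃ (pp : Nat.Primes) (w : (thetaIndex (pilotDataOfK D K)).Fibre (.inr pp)),
        haveI : Fact (pp : ℕ).Prime := ⟨pp.2⟩
        placeOf (pilotDataOfK D K) pp.1 w ∈ (pilotDataOfK D K).S ∧ absRamificationIdx (pp : ℕ) (kOf (pilotDataOfK D K) pp.1 w) = 1 :=
  fun ⟨pp, w, hw, he1⟩ => bridgeHyps_false_pilotDataOfK D pp w hw he1

/-- **abc-iut-rh-typ-9's bridge conclusion `¬ HStar D tq` follows from its hypotheses by `False.elim` ALONE** (no cell analysis): the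
kernel-visible form of «the bridge is vacuous at the genuine datum». [cite: Mochizuki2012, IUTchI Def. 3.1 (c),(e) pp. 61–62] -/
theorem not_hStar_of_absRamificationIdx_eq_one_vacuous
    (tq : ∀ (pp : Nat.Primes) (x : (thetaIndex (pilotDataOfK D K)).Fibre (.inr pp)),
      haveI : Fact (pp : ℕ).Prime := ⟨pp.2⟩; kOf (pilotDataOfK D K) pp.1 x)
    (pp : Nat.Primes) (w : (thetaIndex (pilotDataOfK D K)).Fibre (.inr pp))
    (hw : haveI : Fact (pp : ℕ).Prime := ⟨pp.2⟩; placeOf (pilotDataOfK D K) pp.1 w ∈ (pilotDataOfK D K).S)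
    (he1 : haveI : Fact (pp : ℕ).Prime := ⟨pp.2⟩; absRamificationIdx (pp : ℕ) (kOf (pilotDataOfK D K) pp.1 w) = 1) :
    ¬ HStar D tq :=
  (bridgeHyps_false_pilotDataOfK D pp w hw he1).elim

end Landed

end Summit.ABC.IUTFork.Repair.RHLabelCutJ3K2

end
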